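import Literature.MathematicalPhysics.QuantumFieldTheory.Balaban1983to89.B13InverseLettersOnCoerciveBall
import Literature.MathematicalPhysics.QuantumFieldTheory.Balaban1983to89.B13CoerciveAlongPencilAtOne
import Literature.MathematicalPhysics.QuantumFieldTheory.Balaban1983to89.B13CoerciveIffPosDefInverseBound

/-!
# `Balaban1983to89.B13InverseLettersOnCoerciveBallAtOne` — T. Bałaban, *Propagators for lattice gauge theories in a background field*, Commun. Math. Phys. **99** (1985)
# 389–434 [Balaban1985BackgroundPropagators], (3.26)–(3.27) p. 395 («G(U) = Δ_a(U)⁻¹»), (3.34)–(3.35) p. 396, Thm 3.4 p. 400 («small perturbations of the operators depending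
# on U only»), (3.84)–(3.86) p. 407, Thm 3.10 (3.107)–(3.108) p. 416, Thm 3.11 p. 416; *Propagators … II*, CMP **96** (1984) [Balaban1984PropagatorsII] Lemma 2.1 (2.61)
# p. 234, (2.19) and p. 226; *Renormalization group approach … II*, CMP **116** (1988) [Balaban1988RG2Cluster] (2.5)–(2.7) pp. 12–13, p. 15:
# ★★★ `G = Δ_a⁻¹`'s PENCIL LETTERS AT THE UNIT BACKGROUND ON THE WHOLE CLAUSE BALL — NO DISPLAYED HYPOTHESIS.

statement-level composition of cited tree theorems; kernel-checked; THEOREMS ONLY; nothing of NODE 00's ∕ N06's ∕ the lane's files is modified; nothing here is a claim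
about the Yang–Mills mass gap; no node is discharged; count-neutral.

WHY THIS FILE (cell `pub-ymgap`, HUMAN RULING D-0062 ∕ D-0149, Track A node N10 = [B13]; width seat `pub-ymgap-dag-n10-w2` g4, ASK-NEXT-3 (n1); the `…_one` edition of the lane
owner dag-n10-c g16's module 84 `B13InverseLettersOnCoerciveBall`, invited INBOX l.≈37735 «84 §2 gives the G letters on your explicit ball around `1` in the same breath»).
Module 84 §2 (`rawEntryLetters_toMatrix_GAY_prodCfg_of_coer_centre_ball`) turns Δ_a's pencil letters, a fibre bound and a coercive centre into the (3.108)-letters of NODE 00's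
`G = Ring.inverse Δ_a` on the whole coercivity ball (radius `R′` itself, constant `4∕m′`, a Combes–Thomas rate).  At the unit background every input is a TREE theorem
(`B13CoerciveAlongPencilAtOne` §1: Δ_a's pencil letters at `1` at the v4 letters of record; `B13GreenCentreDecayOfCoercive.exists_coercive_deltaAY_parSymY_one`: the flat
centre's coercivity `∃γ`; `card_fibre_bondReadingY_matrixUnits`: `m_F = (d+1)N²`), so `G(e^{iηA′}·1)`'s letters hold on an explicit chart ball around `1` with NO displayed
analytic or dictionary hypothesis — ON THE SAME BALL on which row 17's clause holds (module 83 at one, `B13CoerciveAlongPencilAtOne` §2).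
* §1 ★★★ `exists_ball_posDefTr_and_rawEntryLetters_toMatrix_GAY_recordV4_prodCfg_one` — for every `η` and `G ≤ U(N)`: `∃ R′ > 0`, (i) `∀ ‖A′‖ < R′, PosDefTr 1 (Δ_a(e^{iηA′}·1))`
  AND (ii) `∃ κ > 0, ∃ B′, RawEntryLetters (A′ ↦ toMatrix B′ B′ (G(e^{iηA′}·1))) (bondReadingY ∘ fst) R′ κ B′` — clause and inverse letters in the same breath, one radius.
* §2 ★★ `exists_rawEntryLetters_toMatrix_GAY_recordV4_prodCfg_one_ball` — (ii) alone.
* §3 (v1.1, APPEND-ONLY; ASK-NEXT-4 (n5), over the lane's module 85 `B13CoerciveIffPosDefInverseBound`) ★★ `exists_ball_coer_deltaAY_parSymY_prodCfg_one` — the lane's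
  QUANTITATIVE `hco` UNIFORMLY on the ball: `∃ R′ > 0, ∃ m′ > 0, ∀ ‖A′‖ < R′, ∀ Ψ, m′⟨Ψ,Ψ⟩₁ ≤ ⟨Ψ, Δ_a(e^{iηA′}·1)Ψ⟩₁` (83 §3 `coer_ball_of_coer_centre_letters` along the pencil
  through `1`); ★★ `exists_ball_posDefTr_and_GAY_formBound_parSymY_prodCfg_one` — PRINT's TWO STATEMENTS, Theorem 3.11's clause AND Theorem 3.3's (3.46)–(3.47) L²-form bound
  `⟨Φ, G(e^{iηA′}·1)Φ⟩₁ ≤ B⟨Φ,Φ⟩₁` with ONE `B = 1∕m′`, for all `‖A′‖ < R′`, NO displayed hypothesis (83 `posDefTr_one_of_coer` + 85 `GAY_formBound_of_coer` pointwise) —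
  exactly the displayed pair `hpd + hGB` of 84's `…_ball_of_posDefTr_of_formBound`, inhabited on an open chart set around the unit background.
* §4 (v1.2, APPEND-ONLY; ASK-NEXT-5 (n7)) ★★ `exists_ball_coer_deltaAY_parSymY_gaugeY_prodCfg_one` — §3's quantitative `hco`, ONE constant, on the OPEN
  GAUGE-INVARIANT neighbourhood of the pure-gauge orbit (the `u`-saturation of the chart ball, unitary-valued `u`): (3.34) `Δ_a(U^u)R(u) = R(u)Δ_a(U)` (def-Y's
  `deltaAY_cov` at the lawful v4 letters) transports the constant (n06's `coer_of_intw_conjY`, BY NAME); ★★ `exists_ball_posDefTr_and_GAY_formBound_parSymY_gaugeY_prodCfg_one`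
  — print's two statements there (Theorem 3.11's clause, Theorem 3.3's L²-form bound for `G`, one `B`), no displayed hypothesis.
RECIPE (finite-lattice, all constants depending on `d, L^k, N` and the flat centre's `γ`): with §1-of-AtOne's `R₁, ρ, B_Δ`, `K := 2·B_Δ·(m_F c₀(1,ρ)^{d+1})`, `R′ := γR₁∕(K+γ)`
(margin `m′ = γ − K R′∕R₁ = γ²∕(K+γ) > 0`), `κ := m′ρ∕(8 B_Δ (m_F c₀(1,ρ∕2)^{d+1}) + 4m′ + 1)` (so `κ ≤ ρ∕4` and `8 B_Δ κ (m_F c₀(1,ρ∕2)^{d+1}) ≤ m′ρ`), constant `4∕m′`.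
HONEST FRAMING: a composition BY NAME; `R′, κ` are EXISTENTIAL (the flat centre's `γ` is n06-j's ∃, per member — not located) and the ball lives in pv27's CHART around
`U₀ = 1` (globally small `A′`), NOT in print's class (3.35); the chart-to-(3.35) passage is print's (3.105)–(3.108) gluing (N06's), untouched; print's multi-scale rate (3.42)
is NOT claimed (one Combes–Thomas rate on the unit torus of blocks); nothing of Bałaban's asserted beyond the cited theorems; N06 ∕ N10 NOT discharged; K1⁹ NOT claimed; counts
unmoved (typed 28∕28 · discharged 5∕27); 0 `def`, 0 `sorry`, standard axioms; one finite 𝕋⁴ programme at fixed ε — R4 closes the conditional finite-𝕋⁴ rung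
`BalabanLadder.UV` only; the YM mass gap (Clay) is NOT proved by any of this; nothing continuum ∕ ℝ⁴ ∕ OS.

References: T. Bałaban, CMP 99 (1985) 389–434 [Balaban1985BackgroundPropagators] (3.26)–(3.27) p.395, (3.34)–(3.35) p.396, Thm 3.4 p.400, (3.84)–(3.86) p.407, Thm 3.10
(3.107)–(3.108) p.416, Thm 3.11 p.416; CMP 96 (1984) 223–250 [Balaban1984PropagatorsII] (2.19) and p.226, Lemma 2.1 (2.61) p.234; CMP 116 (1988) 1–22
[Balaban1988RG2Cluster] (2.5)–(2.7) pp.12–13, p.15; M. Aizenman, S. Warzel, *Random operators*, GSM 168 (2015) [AizenmanWarzel2015] §10.3 (Combes–Thomas).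
-/

noncomputable section

namespace Literature.MathematicalPhysics.QuantumFieldTheory.Balaban1983to89.B13InverseLettersOnCoerciveBallAtOne

open Metric Set Finset Module
open scoped Matrix Matrix.Norms.L2Operator
open Literature.MathematicalPhysics.QuantumFieldTheory.Balaban1983to89
open Literature.MathematicalPhysics.QuantumFieldTheory.Balaban1983to89.B5TorusCover (UT)
open Literature.MathematicalPhysics.QuantumFieldTheory.Balaban1983to89.B9Thm311ReadingCoords (trIP PosDefTr)
open Literature.MathematicalPhysics.QuantumFieldTheory.Balaban1983to89.B13EntrywiseWalks (RawEntryLetters)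
open Literature.MathematicalPhysics.QuantumFieldTheory.Balaban1983to89.B9Eq39Adjoint (prodCfg)
open Literature.MathematicalPhysics.QuantumFieldTheory.Balaban1983to89.B6GlobalChartV1 (PV)
open Literature.MathematicalPhysics.QuantumFieldTheory.Balaban1983to89.B6KLevelCensusIndexV1 (KIdx)
open Literature.MathematicalPhysics.QuantumFieldTheory.Balaban1983to89.B9BackgroundsKLevelV1 (bg9K)
open Literature.MathematicalPhysics.QuantumFieldTheory.Balaban1983to89.Node00 (FBondY CfgY parSymY parBY GpY deltaAY GAY)
open Literature.MathematicalPhysics.QuantumFieldTheory.Balaban1983to89.B13BlockBondReadingNumerals (bondReadingY card_fibre_bondReadingY_matrixUnits)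
open Literature.MathematicalPhysics.QuantumFieldTheory.Balaban1983to89.B13GreenCentreDecayOfCoercive (exists_coercive_deltaAY_parSymY_one)
open Literature.MathematicalPhysics.QuantumFieldTheory.Balaban1983to89.B13CoerciveAlongPencil (posDefTr_deltaAY_prodCfg_of_coer_centre)
open Literature.MathematicalPhysics.QuantumFieldTheory.Balaban1983to89.B13CoerciveAlongPencilAtOne (exists_rawEntryLetters_toMatrix_deltaAY_recordV4_prodCfg_one_located)
open Literature.MathematicalPhysics.QuantumFieldTheory.Balaban1983to89.B13InverseLettersOnCoerciveBall (rawEntryLetters_toMatrix_GAY_prodCfg_of_coer_centre_ball)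
open Literature.MathematicalPhysics.QuantumFieldTheory.Balaban1983to89.B6RandomWalk (c0_nonneg)

variable {d ℓ : ℕ} {hd : 1 ≤ d + 1} {hL : Odd (ℓ + 1) ∧ 1 < ℓ + 1} {b₀ b₁ : ℝ}
variable (i : KIdx d ℓ hd hL b₀ b₁) {N : ℕ} [NeZero N] {G : Subgroup (Matrix (Fin N) (Fin N) ℂ)ˣ}

/-! ## §1. ★★★ Row 17's clause AND `G`'s pencil letters on one chart ball around the unit background — no displayed hypothesis -/

/-- ★★★ **CLAUSE AND INVERSE LETTERS IN THE SAME BREATH, AT `U₀ = 1`.**  For every pencil scale `η` and every `G ≤ U(N)` there is `R′ > 0` such that (i) for every `‖A′‖ < R′`: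
`PosDefTr 1 (Δ_a(e^{iηA′}·1))` (Theorem 3.11's clause for def-Y's v4 `Δ_a`), and (ii) `∃ κ > 0, ∃ B′, RawEntryLetters (A′ ↦ toMatrix B′ B′ (G(e^{iηA′}·1))) (bondReadingY ∘ fst)
R′ κ B′` — NODE 00's `G = Δ_a⁻¹` along the pencil through `1` has the (3.108)-letters ON THE WHOLE BALL (holomorphic entries, Combes–Thomas decay between the blocks, uniform
constant): module 83's `posDefTr_deltaAY_prodCfg_of_coer_centre` and module 84's `rawEntryLetters_toMatrix_GAY_prodCfg_of_coer_centre_ball` at the centre `1` (coercive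
by n06-j's `posDefTr_deltaAY_parSymY_one`, read as `∃γ`), fed by `B13CoerciveAlongPencilAtOne` §1's letters and the located fibre bound `m_F = (d+1)N²`.
HONEST LABEL: `R′, κ, B′` existential (the flat centre's `γ` is ∃, per member); the ball is in pv27's CHART, NOT print's class (3.35); one CT rate, not print's (3.42).
[cite: Balaban1985BackgroundPropagators, (3.26)–(3.27) p.395, Thm 3.4 p.400, (3.84)–(3.86) p.407, Thm 3.10 (3.108) p.416, Thm 3.11 p.416; Balaban1984PropagatorsII,
Lemma 2.1 (2.61) p.234, (2.19) and p.226; Balaban1988RG2Cluster, (2.5)–(2.7) pp.12–13, p.15; AizenmanWarzel2015, §10.3] -/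
theorem exists_ball_posDefTr_and_rawEntryLetters_toMatrix_GAY_recordV4_prodCfg_one
    (hG : G ≤ B7Prop2Explicit.unitaryUnits (Matrix (Fin N) (Fin N) ℂ)) (η : ℝ) :
    ∃ R' : ℝ, 0 < R' ∧
      (∀ a ∈ ball (0 : Fin (d + 1) → Site (PV d ℓ i.m i.K hd hL) 0 → Matrix (Fin N) (Fin N) ℂ) R',
        PosDefTr (fun _ => (1 : ℝ))
          (deltaAY i (parSymY i) (parBY i) (GpY i (parSymY i)) (prodCfg ((bg9K (Matrix (Fin N) (Fin N) ℂ) G i).one) η a))) ∧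
      ∃ κ : ℝ, 0 < κ ∧ ∃ B' : ℝ,
        RawEntryLetters (fun a : Fin (d + 1) → Site (PV d ℓ i.m i.K hd hL) 0 → Matrix (Fin N) (Fin N) ℂ =>
            LinearMap.toMatrix
              ((Pi.basis fun _ : FBondY i => Matrix.stdBasis ℂ (Fin N) (Fin N)).reindex (Equiv.sigmaEquivProd (FBondY i) (Fin N × Fin N)))
              ((Pi.basis fun _ : FBondY i => Matrix.stdBasis ℂ (Fin N) (Fin N)).reindex (Equiv.sigmaEquivProd (FBondY i) (Fin N × Fin N)))
              (GAY i (parSymY i) (parBY i) (GpY i (parSymY i))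
                (prodCfg ((bg9K (Matrix (Fin N) (Fin N) ℂ) G i).one) η a)))
          (fun p : FBondY i × (Fin N × Fin N) => bondReadingY i i.hN p.1) R' κ B' := by
  -- Δ_a's pencil letters at `1` (AtOne §1), the centre's coercivity `γ`, the located fibre bound
  obtain ⟨R₁, hR₁, ρ, hρ, BΔ, hA⟩ := exists_rawEntryLetters_toMatrix_deltaAY_recordV4_prodCfg_one_located i hG η
  obtain ⟨m, hm, hco⟩ := exists_coercive_deltaAY_parSymY_one i (N := N)
  have hco' : ∀ Ψ : FBondY i → Matrix (Fin N) (Fin N) ℂ, m * trIP (fun _ => (1 : ℝ)) Ψ Ψ ≤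
      trIP (fun _ => (1 : ℝ)) Ψ (deltaAY i (parSymY i) (parBY i) (GpY i (parSymY i)) ((bg9K (Matrix (Fin N) (Fin N) ℂ) G i).one) Ψ) := hco
  have hfib : ∀ y, (univ.filter fun k : FBondY i × (Fin N × Fin N) => (fun p : FBondY i × (Fin N × Fin N) => bondReadingY i i.hN p.1) k = y).card ≤
      (d + 1) * (N * N) := fun y => card_fibre_bondReadingY_matrixUnits i i.hN y
  -- the radius `R′ = γR₁∕(K+γ)`, `K = 2·B_Δ·(m_F c₀(1,ρ)^{d+1})`
  have hBΔ : 0 ≤ BΔ := hA.B_nonneg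
  have hC1 : 0 ≤ (((d + 1) * (N * N) : ℕ) : ℝ) * B6.c0 1 ρ ^ (d + 1) := mul_nonneg (Nat.cast_nonneg _) (pow_nonneg (c0_nonneg _ _) _)
  have hC2 : 0 ≤ (((d + 1) * (N * N) : ℕ) : ℝ) * B6.c0 1 (ρ / 2) ^ (d + 1) := mul_nonneg (Nat.cast_nonneg _) (pow_nonneg (c0_nonneg _ _) _)
  set K : ℝ := 2 * (BΔ * ((((d + 1) * (N * N) : ℕ) : ℝ) * B6.c0 1 ρ ^ (d + 1))) with hK
  have hK0 : 0 ≤ K := by positivity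
  have hKm : 0 < K + m := by linarith
  set R' : ℝ := m * R₁ / (K + m) with hR'def
  have hR'0 : 0 < R' := by positivity
  have hR'R : R' ≤ R₁ := by
    rw [hR'def, div_le_iff₀ hKm]; nlinarith
  have hsmall : K * R' < m * R₁ := by
    rw [hR'def, show K * (m * R₁ / (K + m)) = (K * (m * R₁)) / (K + m) by ring, div_lt_iff₀ hKm]
    nlinarith [mul_pos (mul_pos hm hm) hR₁]
  -- the margin `m′ = γ − K R′∕R₁ > 0`
  have hmarg : 0 < m - K * R' / R₁ := by
    rw [sub_pos, div_lt_iff₀ hR₁]; linarith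
  set m' : ℝ := m - K * R' / R₁ with hm'def
  -- the Combes–Thomas rate `κ := m′ρ∕(8 B_Δ C₂ + 4m′ + 1)`
  set D : ℝ := 8 * BΔ * ((((d + 1) * (N * N) : ℕ) : ℝ) * B6.c0 1 (ρ / 2) ^ (d + 1)) + 4 * m' + 1 with hDdef
  have hD8 : 0 ≤ 8 * BΔ * ((((d + 1) * (N * N) : ℕ) : ℝ) * B6.c0 1 (ρ / 2) ^ (d + 1)) := by positivity
  have hD0 : 0 < D := by positivity
  set κ : ℝ := m' * ρ / D with hκdef
  have hκ0 : 0 < κ := by positivity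
  have hκ4 : κ ≤ ρ / 4 := by
    rw [hκdef, div_le_iff₀ hD0]
    nlinarith [mul_pos hmarg hρ]
  have hκm : 8 * BΔ * κ * ((((d + 1) * (N * N) : ℕ) : ℝ) * B6.c0 1 (ρ / 2) ^ (d + 1)) ≤ m' * ρ := by
    have h1 : 8 * BΔ * κ * ((((d + 1) * (N * N) : ℕ) : ℝ) * B6.c0 1 (ρ / 2) ^ (d + 1)) =
        (8 * BΔ * ((((d + 1) * (N * N) : ℕ) : ℝ) * B6.c0 1 (ρ / 2) ^ (d + 1))) * κ := by ring
    rw [h1, hκdef, ← mul_div_assoc, div_le_iff₀ hD0]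
    have h2 : 0 ≤ m' * ρ := (mul_pos hmarg hρ).le
    nlinarith [mul_le_mul_of_nonneg_right (show 8 * BΔ * ((((d + 1) * (N * N) : ℕ) : ℝ) * B6.c0 1 (ρ / 2) ^ (d + 1)) ≤ D by
      rw [hDdef]; linarith) h2]
  refine ⟨R', hR'0, fun a ha => ?_, κ, hκ0, 4 / m', ?_⟩
  · -- (i) row 17's clause on the ball (module 83 at one)
    exact posDefTr_deltaAY_prodCfg_of_coer_centre i (parSymY i) (parBY i) (GpY i (parSymY i)) ((bg9K (Matrix (Fin N) (Fin N) ℂ) G i).one) η hA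
      hρ hfib hm hco' hR'0.le hR'R hsmall a ha
  · -- (ii) `G`'s letters on the same ball (module 84 §2 at one)
    exact rawEntryLetters_toMatrix_GAY_prodCfg_of_coer_centre_ball i (parSymY i) (parBY i) (GpY i (parSymY i)) ((bg9K (Matrix (Fin N) (Fin N) ℂ) G i).one) η
      hA hρ hfib hco' hR'0.le hR'R hmarg hκ0.le hκ4 hκm

/-! ## §2. ★★ `G`'s pencil letters at the unit background on the clause ball -/

/-- ★★ **`G(e^{iηA′}·1)` IN N10 COORDINATES ON A CHART BALL, NO HYPOTHESIS.**  For every `η` and every `G ≤ U(N)`: `∃ R′ > 0, ∃ κ > 0, ∃ B′, RawEntryLetters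
(A′ ↦ toMatrix B′ B′ (G(e^{iηA′}·1))) (bondReadingY ∘ fst) R′ κ B′` at def-Y's v4 letters of record — the entries of NODE 00's `G = Δ_a⁻¹` along the pencil through the unit
background are holomorphic on the ball and decay at a Combes–Thomas rate between the blocks read by `bondReadingY i i.hN` (§1 (ii)).
[cite: Balaban1985BackgroundPropagators, (3.26)–(3.27) p.395, Thm 3.4 p.400, (3.84)–(3.86) p.407, Thm 3.10 (3.108) p.416; Balaban1984PropagatorsII, Lemma 2.1 (2.61) p.234;
Balaban1988RG2Cluster, (2.5)–(2.7) pp.12–13, p.15; AizenmanWarzel2015, §10.3] -/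
theorem exists_rawEntryLetters_toMatrix_GAY_recordV4_prodCfg_one_ball
    (hG : G ≤ B7Prop2Explicit.unitaryUnits (Matrix (Fin N) (Fin N) ℂ)) (η : ℝ) :
    ∃ R' : ℝ, 0 < R' ∧ ∃ κ : ℝ, 0 < κ ∧ ∃ B' : ℝ,
      RawEntryLetters (fun a : Fin (d + 1) → Site (PV d ℓ i.m i.K hd hL) 0 → Matrix (Fin N) (Fin N) ℂ =>
          LinearMap.toMatrix
            ((Pi.basis fun _ : FBondY i => Matrix.stdBasis ℂ (Fin N) (Fin N)).reindex (Equiv.sigmaEquivProd (FBondY i) (Fin N × Fin N)))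
            ((Pi.basis fun _ : FBondY i => Matrix.stdBasis ℂ (Fin N) (Fin N)).reindex (Equiv.sigmaEquivProd (FBondY i) (Fin N × Fin N)))
            (GAY i (parSymY i) (parBY i) (GpY i (parSymY i))
              (prodCfg ((bg9K (Matrix (Fin N) (Fin N) ℂ) G i).one) η a)))
        (fun p : FBondY i × (Fin N × Fin N) => bondReadingY i i.hN p.1) R' κ B' := by
  obtain ⟨R', hR', -, hL⟩ := exists_ball_posDefTr_and_rawEntryLetters_toMatrix_GAY_recordV4_prodCfg_one i hG η
  exact ⟨R', hR', hL⟩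

/-! ## §3. (v1.1) ★★ The quantitative `hco` and print's two statements, uniformly on the chart ball around `1` — no displayed hypothesis -/

section Quantitative

open Literature.MathematicalPhysics.QuantumFieldTheory.Balaban1983to89.B13CoerciveAlongPencil (coer_ball_of_coer_centre_letters posDefTr_one_of_coer)
open Literature.MathematicalPhysics.QuantumFieldTheory.Balaban1983to89.B13CoerciveIffPosDefInverseBound (GAY_formBound_of_coer)
open Literature.MathematicalPhysics.QuantumFieldTheory.Balaban1983to89.B9Eq369Product (prodCfg_zero)

/-- ★★ **THE QUANTITATIVE `hco`, UNIFORMLY ON AN OPEN CHART BALL AROUND `1`.**  For every pencil scale `η` and every `G ≤ U(N)`: `∃ R′ > 0, ∃ m′ > 0` such that for every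
`‖A′‖ < R′` and every `Ψ`: `m′·⟨Ψ,Ψ⟩₁ ≤ ⟨Ψ, Δ_a(e^{iηA′}·1)Ψ⟩₁` — def-Y's v4 `Δ_a` is UNIFORMLY coercive along pv27's pencil through the unit background, with NO
displayed analytic or dictionary hypothesis: module 83 §3 `coer_ball_of_coer_centre_letters` (Schwarz deviation of the letters + Schur) at the centre `1` (coercive by
n06-j's `posDefTr_deltaAY_parSymY_one`, read as `∃γ`), fed by `B13CoerciveAlongPencilAtOne` §1's letters and the located fibre bound `m_F = (d+1)N²`;
`R′ := γR₁∕(K+γ)`, `m′ := γ − K R′∕R₁ = γ²∕(K+γ)`, `K := 2·B_Δ·(m_F c₀(1,ρ)^{d+1})`.  HONEST LABEL: `R′, m′` existential (γ is ∃ per member); CHART ball, NOT (3.35).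
[cite: Balaban1985BackgroundPropagators, (3.26)–(3.27) p.395, Thm 3.4 p.400, Thm 3.10 (3.108) p.416, Thm 3.11 p.416; Balaban1984PropagatorsII, (2.19) and p.226;
Balaban1988RG2Cluster, p.15] -/
theorem exists_ball_coer_deltaAY_parSymY_prodCfg_one
    (hG : G ≤ B7Prop2Explicit.unitaryUnits (Matrix (Fin N) (Fin N) ℂ)) (η : ℝ) :
    ∃ R' : ℝ, 0 < R' ∧ ∃ m' : ℝ, 0 < m' ∧
      ∀ a ∈ ball (0 : Fin (d + 1) → Site (PV d ℓ i.m i.K hd hL) 0 → Matrix (Fin N) (Fin N) ℂ) R',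
        ∀ Ψ : FBondY i → Matrix (Fin N) (Fin N) ℂ,
          m' * trIP (fun _ => (1 : ℝ)) Ψ Ψ ≤
            trIP (fun _ => (1 : ℝ)) Ψ
              (deltaAY i (parSymY i) (parBY i) (GpY i (parSymY i)) (prodCfg ((bg9K (Matrix (Fin N) (Fin N) ℂ) G i).one) η a) Ψ) := by
  -- Δ_a's pencil letters at `1` (AtOne §1), the centre's coercivity `γ` moved to the pencil's origin, the located fibre bound
  obtain ⟨R₁, hR₁, ρ, hρ, BΔ, hA⟩ := exists_rawEntryLetters_toMatrix_deltaAY_recordV4_prodCfg_one_located i hG η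
  obtain ⟨m, hm, hco⟩ := exists_coercive_deltaAY_parSymY_one i (N := N)
  have hco0 : ∀ Ψ : FBondY i → Matrix (Fin N) (Fin N) ℂ, m * trIP (fun _ => (1 : ℝ)) Ψ Ψ ≤
      trIP (fun _ => (1 : ℝ)) Ψ (deltaAY i (parSymY i) (parBY i) (GpY i (parSymY i))
        (prodCfg ((bg9K (Matrix (Fin N) (Fin N) ℂ) G i).one) η 0) Ψ) := by
    intro Ψ; rw [prodCfg_zero]; exact hco Ψ
  have hfib : ∀ y, (univ.filter fun k : FBondY i × (Fin N × Fin N) => (fun p : FBondY i × (Fin N × Fin N) => bondReadingY i i.hN p.1) k = y).card ≤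
      (d + 1) * (N * N) := fun y => card_fibre_bondReadingY_matrixUnits i i.hN y
  -- the radius `R′ = γR₁∕(K+γ)` and the margin `m′ = γ − K R′∕R₁ > 0`
  have hBΔ : 0 ≤ BΔ := hA.B_nonneg
  have hC1 : 0 ≤ (((d + 1) * (N * N) : ℕ) : ℝ) * B6.c0 1 ρ ^ (d + 1) := mul_nonneg (Nat.cast_nonneg _) (pow_nonneg (c0_nonneg _ _) _)
  set K : ℝ := 2 * (BΔ * ((((d + 1) * (N * N) : ℕ) : ℝ) * B6.c0 1 ρ ^ (d + 1))) with hK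
  have hK0 : 0 ≤ K := by positivity
  have hKm : 0 < K + m := by linarith
  set R' : ℝ := m * R₁ / (K + m) with hR'def
  have hR'0 : 0 < R' := by positivity
  have hR'R : R' ≤ R₁ := by
    rw [hR'def, div_le_iff₀ hKm]; nlinarith
  have hsmall : K * R' < m * R₁ := by
    rw [hR'def, show K * (m * R₁ / (K + m)) = (K * (m * R₁)) / (K + m) by ring, div_lt_iff₀ hKm]
    nlinarith [mul_pos (mul_pos hm hm) hR₁]
  have hmarg : 0 < m - K * R' / R₁ := by
    rw [sub_pos, div_lt_iff₀ hR₁]; linarith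
  -- coercivity with margin `m′` at every point of the ball (module 83 §3)
  have hball : ∀ a ∈ ball (0 : Fin (d + 1) → Site (PV d ℓ i.m i.K hd hL) 0 → Matrix (Fin N) (Fin N) ℂ) R',
      ∀ Ψ : FBondY i → Matrix (Fin N) (Fin N) ℂ,
        (m - K * R' / R₁) * trIP (fun _ => (1 : ℝ)) Ψ Ψ ≤
          trIP (fun _ => (1 : ℝ)) Ψ
            (deltaAY i (parSymY i) (parBY i) (GpY i (parSymY i)) (prodCfg ((bg9K (Matrix (Fin N) (Fin N) ℂ) G i).one) η a) Ψ) :=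
    coer_ball_of_coer_centre_letters _ hA hρ hfib hco0 hR'0.le hR'R
  exact ⟨R', hR'0, m - K * R' / R₁, hmarg, hball⟩

/-- ★★ **PRINT's TWO STATEMENTS ON AN OPEN CHART BALL AROUND `1`, NO HYPOTHESIS.**  For every `η` and every `G ≤ U(N)`: `∃ R′ > 0, ∃ B > 0` such that for every `‖A′‖ < R′`:
Theorem 3.11's clause `PosDefTr 1 (Δ_a(e^{iηA′}·1))` AND Theorem 3.3's (3.46)–(3.47) global L²-form bound `⟨Φ, G(e^{iηA′}·1)Φ⟩₁ ≤ B·⟨Φ,Φ⟩₁` for NODE 00's `G = Δ_a⁻¹`, with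
ONE constant `B = 1∕m′` on the whole ball — §3's uniform coercivity read through module 83's `posDefTr_one_of_coer` and module 85's located «⟹» `GAY_formBound_of_coer`.
This is exactly the displayed pair `hpd + hGB` of module 84's `rawEntryLetters_toMatrix_GAY_parSymY_prodCfg_ball_of_posDefTr_of_formBound` (and of the G-station of
record), inhabited with no hypothesis on an open chart set around the unit background.  HONEST LABEL: CHART ball, NOT print's class (3.35); `R′, B` existential.
[cite: Balaban1985BackgroundPropagators, (3.26)–(3.27) p.395, (3.46)–(3.47) p.398, Thm 3.3 p.399, Thm 3.4 p.400, Thm 3.11 p.416; Balaban1984PropagatorsII, p.226;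
Balaban1988RG2Cluster, p.15] -/
theorem exists_ball_posDefTr_and_GAY_formBound_parSymY_prodCfg_one
    (hG : G ≤ B7Prop2Explicit.unitaryUnits (Matrix (Fin N) (Fin N) ℂ)) (η : ℝ) :
    ∃ R' : ℝ, 0 < R' ∧ ∃ B : ℝ, 0 < B ∧
      ∀ a ∈ ball (0 : Fin (d + 1) → Site (PV d ℓ i.m i.K hd hL) 0 → Matrix (Fin N) (Fin N) ℂ) R',
        PosDefTr (fun _ => (1 : ℝ))
            (deltaAY i (parSymY i) (parBY i) (GpY i (parSymY i)) (prodCfg ((bg9K (Matrix (Fin N) (Fin N) ℂ) G i).one) η a)) ∧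
          ∀ Φ : FBondY i → Matrix (Fin N) (Fin N) ℂ,
            trIP (fun _ => (1 : ℝ)) Φ
                (GAY i (parSymY i) (parBY i) (GpY i (parSymY i)) (prodCfg ((bg9K (Matrix (Fin N) (Fin N) ℂ) G i).one) η a) Φ) ≤
              B * trIP (fun _ => (1 : ℝ)) Φ Φ := by
  obtain ⟨R', hR', m', hm', hball⟩ := exists_ball_coer_deltaAY_parSymY_prodCfg_one i hG η
  exact ⟨R', hR', m'⁻¹, inv_pos.2 hm', fun a ha =>
    ⟨posDefTr_one_of_coer _ hm' (hball a ha),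
      fun Φ => GAY_formBound_of_coer i (parSymY i) (parBY i) (GpY i (parSymY i)) _ hm' (hball a ha) Φ⟩⟩

end Quantitative

/-! ## §4. (v1.2) ★★ … and on the open gauge-invariant neighbourhood of the pure-gauge orbit -/

section GaugeOrbit

open Literature.MathematicalPhysics.QuantumFieldTheory.Balaban1983to89.Node00 (GaugeY gaugeY deltaAY_cov parBY_isGaugeLawB GpY_isCovSiteOpY parSymY_isGaugeLawS)
open Literature.MathematicalPhysics.QuantumFieldTheory.Balaban1983to89.B9Thm311DeltaAGaugeOrbit (gBondY_mem_unitary)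
open Literature.MathematicalPhysics.QuantumFieldTheory.Balaban1983to89.B9Thm311CoercivePureGaugeAtLettersY (coer_of_intw_conjY)
open Literature.MathematicalPhysics.QuantumFieldTheory.Balaban1983to89.B13CoerciveAlongPencil (posDefTr_one_of_coer)
open Literature.MathematicalPhysics.QuantumFieldTheory.Balaban1983to89.B13CoerciveIffPosDefInverseBound (GAY_formBound_of_coer)

/-- ★★ **THE QUANTITATIVE `hco` ON THE GAUGE-INVARIANT NEIGHBOURHOOD OF THE PURE-GAUGE ORBIT.**  For every `η` and every `G ≤ U(N)`: `∃ R′ > 0, ∃ m′ > 0` such that for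
every unitary-valued gauge transformation `u`, every `‖A′‖ < R′` and every `Ψ`: `m′·⟨Ψ,Ψ⟩₁ ≤ ⟨Ψ, Δ_a((e^{iηA′}·1)^u)Ψ⟩₁` — ONE constant on the `u`-saturation of §3's
chart ball (an open, gauge-invariant set containing the whole pure-gauge orbit `1^u`): (3.34) `Δ_a(U^u)R(u) = R(u)Δ_a(U)` (def-Y's `deltaAY_cov` at the lawful v4 letters
`parSymY ∕ parBY ∕ GpY parSymY`) and the `R(u)`-isometry of the trace pairing transport §3's constant unchanged (n06's `coer_of_intw_conjY`, exactly as
`exists_coer_deltaAY_parSymY_pureGauge` does at `A′ = 0`).  HONEST LABEL: `R′, m′` existential per member; chart set, NOT print's class (3.35).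
[cite: Balaban1985BackgroundPropagators, (3.34)–(3.35) p.396, Thm 3.4 p.400, Thm 3.11 p.416; Balaban1984PropagatorsII, p.226; Balaban1988RG2Cluster, p.15] -/
theorem exists_ball_coer_deltaAY_parSymY_gaugeY_prodCfg_one
    (hG : G ≤ B7Prop2Explicit.unitaryUnits (Matrix (Fin N) (Fin N) ℂ)) (η : ℝ) :
    ∃ R' : ℝ, 0 < R' ∧ ∃ m' : ℝ, 0 < m' ∧ ∀ {u : GaugeY (Matrix (Fin N) (Fin N) ℂ) i},
      (∀ x, ((u x : (Matrix (Fin N) (Fin N) ℂ)ˣ) : Matrix (Fin N) (Fin N) ℂ) ∈ unitary _) →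
      ∀ a ∈ ball (0 : Fin (d + 1) → Site (PV d ℓ i.m i.K hd hL) 0 → Matrix (Fin N) (Fin N) ℂ) R',
        ∀ Ψ : FBondY i → Matrix (Fin N) (Fin N) ℂ,
          m' * trIP (fun _ => (1 : ℝ)) Ψ Ψ ≤
            trIP (fun _ => (1 : ℝ)) Ψ
              (deltaAY i (parSymY i) (parBY i) (GpY i (parSymY i))
                (gaugeY i u (prodCfg ((bg9K (Matrix (Fin N) (Fin N) ℂ) G i).one) η a)) Ψ) := by
  obtain ⟨R', hR', m', hm', hball⟩ := exists_ball_coer_deltaAY_parSymY_prodCfg_one i hG η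
  exact ⟨R', hR', m', hm', fun hu a ha Ψ =>
    coer_of_intw_conjY (gBondY_mem_unitary i hu)
      (deltaAY_cov (U := prodCfg ((bg9K (Matrix (Fin N) (Fin N) ℂ) G i).one) η a) (parSymY_isGaugeLawS i) (parBY_isGaugeLawB i)
        (GpY_isCovSiteOpY (parSymY_isGaugeLawS i)))
      (hball a ha) Ψ⟩

/-- ★★ **PRINT's TWO STATEMENTS ON THE GAUGE-INVARIANT NEIGHBOURHOOD OF THE PURE-GAUGE ORBIT, NO HYPOTHESIS.**  For every `η` and every `G ≤ U(N)`: `∃ R′ > 0, ∃ B > 0`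
such that for every unitary-valued `u` and every `‖A′‖ < R′`: Theorem 3.11's clause `PosDefTr 1 (Δ_a((e^{iηA′}·1)^u))` AND Theorem 3.3's (3.46)–(3.47) L²-form bound
`⟨Φ, G((e^{iηA′}·1)^u)Φ⟩₁ ≤ B·⟨Φ,Φ⟩₁`, ONE `B = 1∕m′` — the preceding theorem read through module 83's `posDefTr_one_of_coer` and module 85's `GAY_formBound_of_coer` at
`U^u`: the junction's displayed pair `hpd + hGB` inhabited on an open GAUGE-INVARIANT set around the pure-gauge orbit (census v21's «open gauge-invariant class around
the orbit», quantitative and hypothesis-free at the orbit of `1`).  HONEST LABEL: chart set, NOT print's class (3.35); `R′, B` existential per member.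
[cite: Balaban1985BackgroundPropagators, (3.26)–(3.27) p.395, (3.34)–(3.35) p.396, (3.46)–(3.47) p.398, Thm 3.3 p.399, Thm 3.11 p.416; Balaban1984PropagatorsII, p.226;
Balaban1988RG2Cluster, p.15] -/
theorem exists_ball_posDefTr_and_GAY_formBound_parSymY_gaugeY_prodCfg_one
    (hG : G ≤ B7Prop2Explicit.unitaryUnits (Matrix (Fin N) (Fin N) ℂ)) (η : ℝ) :
    ∃ R' : ℝ, 0 < R' ∧ ∃ B : ℝ, 0 < B ∧ ∀ {u : GaugeY (Matrix (Fin N) (Fin N) ℂ) i},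
      (∀ x, ((u x : (Matrix (Fin N) (Fin N) ℂ)ˣ) : Matrix (Fin N) (Fin N) ℂ) ∈ unitary _) →
      ∀ a ∈ ball (0 : Fin (d + 1) → Site (PV d ℓ i.m i.K hd hL) 0 → Matrix (Fin N) (Fin N) ℂ) R',
        PosDefTr (fun _ => (1 : ℝ))
            (deltaAY i (parSymY i) (parBY i) (GpY i (parSymY i))
              (gaugeY i u (prodCfg ((bg9K (Matrix (Fin N) (Fin N) ℂ) G i).one) η a))) ∧
          ∀ Φ : FBondY i → Matrix (Fin N) (Fin N) ℂ,
            trIP (fun _ => (1 : ℝ)) Φ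
                (GAY i (parSymY i) (parBY i) (GpY i (parSymY i))
                  (gaugeY i u (prodCfg ((bg9K (Matrix (Fin N) (Fin N) ℂ) G i).one) η a)) Φ) ≤
              B * trIP (fun _ => (1 : ℝ)) Φ Φ := by
  obtain ⟨R', hR', m', hm', hball⟩ := exists_ball_coer_deltaAY_parSymY_gaugeY_prodCfg_one i hG η
  exact ⟨R', hR', m'⁻¹, inv_pos.2 hm', fun hu a ha =>
    ⟨posDefTr_one_of_coer _ hm' (hball hu a ha),
      fun Φ => GAY_formBound_of_coer i (parSymY i) (parBY i) (GpY i (parSymY i)) _ hm' (hball hu a ha) Φ⟩⟩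

end GaugeOrbit

end Literature.MathematicalPhysics.QuantumFieldTheory.Balaban1983to89.B13InverseLettersOnCoerciveBallAtOne

end
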